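/-
Origin: expansion seat `prover-pub-hodgecm-mc-binder-1-g17-0`, handover #1242r2 2026-08-20T22:31:33Z md5 7ef492ac318c (187 l.; REPLACE of HodgeCM/Model/AdelicThetaTowerMap.lean — PKG file now 09ab67112f85 (191 l., incl. packager Origin header); body of record cf1f80e516a9 (187 l.) → 7ef492ac318c; owner sinst-1 #1242 (RUN 64) — CONSENT: sinst-1-g10 STATUS l.14541; token strike only: res_clsAt minus the binder (h₂ : SpecialCyclesAlgebraic); NAMES for audit: HodgeCM.Model.ThetaAdelicSide.res_clsAt) (`HOME/mc/pub-hodgecm-mc-binder-1-g17/campaign/new/AdelicThetaTowerMap.lean`, md5 7ef492ac318c, 187 lines);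
landed by the gen-27 packager (p-g27) in gate run 65 REPLACES the earlier landed copy of `HodgeCM/Model/AdelicThetaTowerMap.lean` (verbatim).
-/
/-
Copyright (c) 2026 the pub-hodgecm formalisation cell (harness21).  New file, not vendored.
Origin: session prover-pub-hodgecm-mc-sinst-1-g9-0 (unit pub-hodgecm-mc-sinst-1-g9, S-INSTANCE CONSTRUCTOR gen 9; the (J2)↔(J4) seam of the
(J-Liu-Θ) junction behind E's row 9 `hΘ`, packaging: the class map as a linear map, its `U(V)(𝔸_f)`-equivariance in `ℂ[G]`-module form,
its restriction to the identity component), 2026-08-20.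
Intended final place: `HodgeCM/Model/AdelicThetaTowerMap.lean` (NEW additive model-layer leaf; imports sinst-1's
`HodgeCM.Model.AdelicThetaTowerAction` (#1241) and binder-1's `HodgeCM.Model.TowerAlgebra` (#R112), `HodgeCM.Model.TowerRes` (#R111);
nothing imports it; drop alone).
-/
import Summits.HodgeConjecture.HodgeCM.Model.AdelicThetaTowerAction
import Summits.HodgeConjecture.HodgeCM.Model.TowerAlgebra
import Summits.HodgeConjecture.HodgeCM.Model.TowerRes

set_option autoImplicit false

/-!
# The tower class map of a slot: `cls_Γ : (saturated hol-germ theta forms of level K) →ₗ[ℂ] Tower`, equivariance, restriction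

For an adelic side `S` with the honest archimedean component (`S.ιinf = archInfOf V`), regime `hV`, slot `k`, weight functions `𝓕`,
and a level `Γ` below a conjugate of `K_f(3)`:
* `S.holSat hV k Γ 𝓕 : Submodule ℂ (G_U(𝔸) → ℂ²)` — the elements of the slot's adèlic theta module saturated at `sat(Γ.K)` with holomorphic
  germs along `S.ιinf` (`adelicThetaSpanSat … ⊓ holGerms S.ιinf`); `rightShift (finToG g)` maps `holSat Γ` into `holSat (Γ.conj g)`
  (`rightShift_mem_holSat_conj`), `holSat Γ ≤ holSat Γ'` for `Γ' ≤ Γ` (`holSat_mono`);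
* **`S.clsAt … hι hV k Γ hΓ 𝓕 : S.holSat hV k Γ 𝓕 →ₗ[ℂ] Tower … V`**, `F ↦ ofLevel Γ ⟨towerFamily F, _⟩` (#1240/#1241: linear by
  `towerFamily_add/_smul`);
* **`clsAt_rightShift`**: `clsAt (Γ.conj g) (R_{e_g} F) = act g (clsAt Γ F)` and its `ℂ[U(V)(𝔸_f)]`-module form **`of_smul_clsAt`**
  (`MonoidAlgebra.of ℂ _ g • clsAt Γ F = clsAt (Γ.conj g) (R_{e_g} F)`, #R112 `of_smul_eq_act`) — the equivariance the junction's
  `EquivariantLift.lift` (#1237) consumes; `of_smul_clsAt_of_mem` (`K`-fixedness, #R112 `of_smul_ofLevel`);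
* `clsAt_of_le` — independence of the level; `clsAt_mem_levelImage`;
* **`res_clsAt`**: binder-1's `res Γ hΓ (clsAt Γ F)` (#R111) is THE `(1,0)`-class of `P_Γ` whose harmonic pull-back is `F ∘ S.ιinf`
  — so for a theta class `ω` with a saturated hol-germ lift `F`, `clsAt Γ F` is the vector the junction's `hIso`/`hfam` asks for, modulo
  the block-membership clause (the `Ω`/`θ̄` typing, theta-3 O5 + axioms-1 (T1′)).
KERNEL only: 0 records, 0 `def … : Prop`, nothing cited; `#print axioms` ⊆ {propext, Classical.choice, Quot.sound}.
-/

noncomputable section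

open MulAction NumberField
open Literature.NumberTheory.Automorphic Literature.NumberTheory.Weil1964
open Literature.NumberTheory.Automorphic.WeightForms (restrictHom thetaClasses IsLevelCorrected IsWeightMatched)
open Literature.Geometry.ComplexHyperbolic.BallModel (U21 x₀)
open Literature.AlgebraicGeometry.HodgeTheory Literature.AlgebraicGeometry.ShimuraVarieties
open Literature.NumberTheory.Automorphic.PicardCM
open Literature.NumberTheory.Transcendental (Arapura2012_Cor_15_4_6)
open HodgeCM.Model.SupplyResidual HodgeCM.Model.ThetaSpace HodgeCM.Model.LevelTranslate HodgeCM.Model.TowerLevel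
open HodgeCM.Model.TowerCarrier

namespace HodgeCM
namespace Model

namespace ThetaAdelicSide

section HolSat

variable {L : CMField} {ι₁ : L →+* ℂ} {V : HermSpace3 L ι₁} {c : SeesawCtx L} (S : ThetaAdelicSide V c)

/-- **The saturated hol-germ part of the slot's adèlic theta module at level `Γ`**: elements of the adèlic theta module of `(S.P k)`
(weight `weightOf x₀` on `Stab(x₀)`, weight functions `𝓕`) SATURATED at `sat(Γ.K)` with HOLOMORPHIC GERMS along `S.ιinf`. -/
def holSat (hV : IsAnisotropic L V.Hm) (k : Fin 4) (Γ : Level V)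
    (𝓕 : Set C(NumberField.relNormOneIdeles (↥(maximalRealSubfield L)) L ⧸
      NumberField.relNormOneRat (↥(maximalRealSubfield L)) L, ℂ)) :
    Submodule ℂ ((V.latticeModel printFact_unitaryCompact_holds).G → (Fin 2 → ℂ)) :=
  adelicThetaSpanSat (S.P k) S.ιinf (stabilizer U21 x₀).subtype (BallForms.isPullbackCocycle_cotangentCocycle.weightOf x₀)
      (satLevelRegimeOf V hV Γ.K) 𝓕 ⊓
    holGerms S.ιinf

variable {𝓕 : Set C(NumberField.relNormOneIdeles (↥(maximalRealSubfield L)) L ⧸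
    NumberField.relNormOneRat (↥(maximalRealSubfield L)) L, ℂ)}

/-- (Ported verbatim from the HodgeCMPerL package; no docstring in the source.) -/
theorem mem_holSat_iff (hV : IsAnisotropic L V.Hm) (k : Fin 4) (Γ : Level V)
    {F : (V.latticeModel printFact_unitaryCompact_holds).G → (Fin 2 → ℂ)} :
    F ∈ S.holSat hV k Γ 𝓕 ↔
      F ∈ adelicThetaSpanSat (S.P k) S.ιinf (stabilizer U21 x₀).subtype
          (BallForms.isPullbackCocycle_cotangentCocycle.weightOf x₀) (satLevelRegimeOf V hV Γ.K) 𝓕 ∧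
        IsHolGerm S.ιinf F :=
  Submodule.mem_inf

/-- `holSat Γ ≤ holSat Γ'` for `Γ' ≤ Γ` (a deeper saturation subgroup is smaller). -/
theorem holSat_mono (hV : IsAnisotropic L V.Hm) (k : Fin 4) {Γ Γ' : Level V} (hle : Γ' ≤ Γ) :
    S.holSat hV k Γ 𝓕 ≤ S.holSat hV k Γ' 𝓕 := fun _ hF =>
  ⟨S.mem_adelicThetaSpanSat_of_le hV k hle hF.1, hF.2⟩

/-- `holSat Γ` lies in the slot's adèlic theta module. -/
theorem holSat_le_adelicThetaSpan (hV : IsAnisotropic L V.Hm) (k : Fin 4) (Γ : Level V) :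
    S.holSat hV k Γ 𝓕 ≤ adelicThetaSpan (S.P k) S.ιinf (stabilizer U21 x₀).subtype
      (BallForms.isPullbackCocycle_cotangentCocycle.weightOf x₀) 𝓕 := fun _ hF =>
  adelicThetaSpanSat_le_adelicThetaSpan hF.1

/-- **Right translation by `e_g` maps `holSat Γ` into `holSat (Γ.conj g)`.** -/
theorem rightShift_mem_holSat_conj (hV : IsAnisotropic L V.Hm) (k : Fin 4) {Γ : Level V} (hΓ : Γ.BelowConjThree)
    {F : (V.latticeModel printFact_unitaryCompact_holds).G → (Fin 2 → ℂ)} (hF : F ∈ S.holSat hV k Γ 𝓕) (g : V.adelicFin) :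
    rightShift (finToG V hV g) F ∈ S.holSat hV k (Γ.conj g hΓ) 𝓕 :=
  ⟨rightShift_mem_adelicThetaSpanSat_of_conj (S.commute_finToG_ιinf hV g)
      (fun _ ha => finToG_inv_mul_mul_mem_satLevelRegimeOf V hV hΓ g ha) hF.1,
    hF.2.comp_mul_right (S.commute_finToG_ιinf hV g)⟩

end HolSat

section Cls

variable (hHD : exists_isReal_hodgeModel) (hI : hodgePQ_independent_of_hodgeModel)
  (h₁ : BallQuotientUniformised) (h₃ : CMAbelianVarietyRealised) (hA : Arapura2012_Cor_15_4_6)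
variable {L : CMField} {ι₁ : L →+* ℂ} {V : HermSpace3 L ι₁} {c : SeesawCtx L} (S : ThetaAdelicSide V c)

/-- **The tower class map at level `Γ`**: `F ↦ ofLevel Γ (towerFamily F) ∈ Tower … V` on `holSat Γ`, a `ℂ`-linear map. -/
def clsAt (hι : S.ιinf = archInfOf V) (hV : IsAnisotropic L V.Hm) (k : Fin 4) (Γ : Level V) (hΓ : Γ.BelowConjThree)
    (𝓕 : Set C(NumberField.relNormOneIdeles (↥(maximalRealSubfield L)) L ⧸
      NumberField.relNormOneRat (↥(maximalRealSubfield L)) L, ℂ)) :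
    S.holSat hV k Γ 𝓕 →ₗ[ℂ] Tower hHD hI (ballQuotientUniformisedDatum_of h₁) h₃ hA V where
  toFun F := ofLevel hHD hI (ballQuotientUniformisedDatum_of h₁) h₃ hA Γ hΓ
    ⟨_, S.towerFamily_mem hHD hI h₁ h₃ hA hι hV hΓ F.2.1 F.2.2⟩
  map_add' F F' := by
    rw [← map_add]
    congr 1
    apply Subtype.ext
    funext h
    exact S.towerFamily_add hHD hI h₁ h₃ hV hΓ F.2.1 F'.2.1 F.2.2 F'.2.2 h
  map_smul' r F := by
    rw [RingHom.id_apply, ← map_smul]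
    congr 1
    apply Subtype.ext
    funext h
    exact S.towerFamily_smul hHD hI h₁ h₃ hV hΓ F.2.1 F.2.2 r h

variable {𝓕 : Set C(NumberField.relNormOneIdeles (↥(maximalRealSubfield L)) L ⧸
    NumberField.relNormOneRat (↥(maximalRealSubfield L)) L, ℂ)}

/-- (Ported verbatim from the HodgeCMPerL package; no docstring in the source.) -/
theorem clsAt_apply (hι : S.ιinf = archInfOf V) (hV : IsAnisotropic L V.Hm) (k : Fin 4) {Γ : Level V} (hΓ : Γ.BelowConjThree)
    (F : S.holSat hV k Γ 𝓕) :
    S.clsAt hHD hI h₁ h₃ hA hι hV k Γ hΓ 𝓕 F =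
      ofLevel hHD hI (ballQuotientUniformisedDatum_of h₁) h₃ hA Γ hΓ
        ⟨_, S.towerFamily_mem hHD hI h₁ h₃ hA hι hV hΓ F.2.1 F.2.2⟩ := rfl

/-- The class lies in the image of level `K`. -/
theorem clsAt_mem_levelImage (hι : S.ιinf = archInfOf V) (hV : IsAnisotropic L V.Hm) (k : Fin 4) {Γ : Level V}
    (hΓ : Γ.BelowConjThree) (F : S.holSat hV k Γ 𝓕) :
    S.clsAt hHD hI h₁ h₃ hA hι hV k Γ hΓ 𝓕 F ∈ TowerCarrier.levelImage hHD hI (ballQuotientUniformisedDatum_of h₁) h₃ hA Γ hΓ :=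
  ofLevel_mem_levelImage hHD hI (ballQuotientUniformisedDatum_of h₁) h₃ hA Γ hΓ _

/-- **Equivariance**: `clsAt (Γ.conj g) (R_{e_g} F) = act g (clsAt Γ F)`. -/
theorem clsAt_rightShift (hι : S.ιinf = archInfOf V) (hV : IsAnisotropic L V.Hm) (k : Fin 4) {Γ : Level V}
    (hΓ : Γ.BelowConjThree) (F : S.holSat hV k Γ 𝓕) (g : V.adelicFin) :
    S.clsAt hHD hI h₁ h₃ hA hι hV k (Γ.conj g hΓ) (hΓ.conj g) 𝓕 ⟨_, S.rightShift_mem_holSat_conj hV k hΓ F.2 g⟩ =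
      act hHD hI (ballQuotientUniformisedDatum_of h₁) h₃ hA g (S.clsAt hHD hI h₁ h₃ hA hι hV k Γ hΓ 𝓕 F) := by
  rw [clsAt_apply, clsAt_apply,
    ← S.ofLevel_towerFamily_adelicThetaRepFin hHD hI h₁ h₃ hA hι hV hΓ
      (F := ⟨F.1, S.holSat_le_adelicThetaSpan hV k Γ F.2⟩) F.2.1 F.2.2 g]
  rfl

/-- **Equivariance, `ℂ[U(V)(𝔸_f)]`-module form** (#R112 `of_smul_eq_act`): `of g • clsAt Γ F = clsAt (Γ.conj g) (R_{e_g} F)`. -/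
theorem of_smul_clsAt (hι : S.ιinf = archInfOf V) (hV : IsAnisotropic L V.Hm) (k : Fin 4) {Γ : Level V}
    (hΓ : Γ.BelowConjThree) (F : S.holSat hV k Γ 𝓕) (g : V.adelicFin) :
    MonoidAlgebra.of ℂ ↥V.adelicFin g • S.clsAt hHD hI h₁ h₃ hA hι hV k Γ hΓ 𝓕 F =
      S.clsAt hHD hI h₁ h₃ hA hι hV k (Γ.conj g hΓ) (hΓ.conj g) 𝓕 ⟨_, S.rightShift_mem_holSat_conj hV k hΓ F.2 g⟩ := by
  rw [of_smul_eq_act, clsAt_rightShift]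

/-- **`K`-fixedness**: `of k • clsAt Γ F = clsAt Γ F` for `k ∈ Γ.K` (#R112 `of_smul_ofLevel`). -/
theorem of_smul_clsAt_of_mem (hι : S.ιinf = archInfOf V) (hV : IsAnisotropic L V.Hm) (k : Fin 4) {Γ : Level V}
    (hΓ : Γ.BelowConjThree) (F : S.holSat hV k Γ 𝓕) {kf : V.adelicFin} (hk : kf ∈ Γ.K) :
    MonoidAlgebra.of ℂ ↥V.adelicFin kf • S.clsAt hHD hI h₁ h₃ hA hι hV k Γ hΓ 𝓕 F = S.clsAt hHD hI h₁ h₃ hA hι hV k Γ hΓ 𝓕 F :=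
  of_smul_ofLevel hHD hI (ballQuotientUniformisedDatum_of h₁) h₃ hA hΓ hk _

/-- **Independence of the level**: reading `F ∈ holSat Γ` at a smaller level `Γ' ≤ Γ` gives the same class. -/
theorem clsAt_of_le (hι : S.ιinf = archInfOf V) (hV : IsAnisotropic L V.Hm) (k : Fin 4) {Γ Γ' : Level V} (hle : Γ' ≤ Γ)
    (hΓ : Γ.BelowConjThree) (hΓ' : Γ'.BelowConjThree) (F : S.holSat hV k Γ 𝓕) :
    S.clsAt hHD hI h₁ h₃ hA hι hV k Γ' hΓ' 𝓕 ⟨F.1, S.holSat_mono hV k hle F.2⟩ = S.clsAt hHD hI h₁ h₃ hA hι hV k Γ hΓ 𝓕 F := by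
  rw [clsAt_apply, clsAt_apply]
  exact S.ofLevel_towerFamily_of_le hHD hI h₁ h₃ hA hι hV hle hΓ hΓ' F.2.1 F.2.2

/-- **Restriction to the identity component**: binder-1's `res Γ` of the class is THE `(1,0)`-class of `P_Γ` whose harmonic
pull-back is `F ∘ S.ιinf`. -/
theorem res_clsAt (hι : S.ιinf = archInfOf V) (hV : IsAnisotropic L V.Hm) (k : Fin 4)
    {Γ : Level V} (hΓ : Γ.BelowConjThree) (F : S.holSat hV k Γ 𝓕) (cl : (pinD hHD hI h₁ h₃ Γ hV).H10)
    (hcl : ((pinD hHD hI h₁ h₃ Γ hV).pull cl).1 = F.1 ∘ S.ιinf) :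
    TowerCarrier.res hHD hI (ballQuotientUniformisedDatum_of h₁) h₃ hA Γ hΓ (S.clsAt hHD hI h₁ h₃ hA hι hV k Γ hΓ 𝓕 F) =
      (cl : (picardCMUniverse hHD hI h₁ h₃).CohC ((picardCMUniverse hHD hI h₁ h₃).pms L ι₁ V Γ) 1) := by
  rw [clsAt_apply, res_ofLevel]
  exact S.res_towerFamily hHD hI h₁ h₃ hA hV hΓ F.2.1 F.2.2 _ cl hcl

end Cls

end ThetaAdelicSide

end Model
end HodgeCM

end
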